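import Summits.QuantumFields.BalabanUV.T4Continuum.Support.NE7OneStepLetters
import Summits.QuantumFields.BalabanUV.T4Continuum.Support.AveragingDeficitMultiLevelFermat
import HarnessLib

/-!
# NE7CriticalMultiplier — THE LAGRANGE-MULTIPLIER FORM OF CRITICALITY: a configuration whose first variation vanishes on the kernel of the
# differential `levelQ'` of the multi-level constraint has `dAction U ψ = Λ(levelQ' ψ)` for EVERY skew torus direction, with a linear
# multiplier `Λ` on the coarse `𝔲(N)` fields (first isomorphism theorem + the tree's submersion `levelQ'_onto`), and `Λ` is `O(radius)` on every
# skew preimage ([Balaban1985Variational] (93)∕(141) «⟨𝒥, δA⟩ = 0 for all δA : QδA = 0 …» ⟹ the Euler–Lagrange system with a coarse multiplier)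

Cell `pub-balaban`, rung (B)+1 sub-cell t4, lineage `b2b-balaban-t4-ne7-p1`, generation 66 (CRUX PROVER NE7 #1); hunt (h10) «ONE-STEP = CRIT ∧ CONV»,
memo `t4/b2b-balaban-t4-ne7-p1-g66/HUNT-H10-TWO-ROADS.md` §3 (step 1 of BOTH roads to CRIT-ONE-STEP: the Euler–Lagrange system with multiplier).
File F8.

WHAT ([folklore]; 0 def, 0 sorry).
§1 **`exists_factor_of_ker_le`** — linear algebra: `f : M →ₗ P`, `Q : M →ₗ N` surjective, `ker Q ≤ ker f` ⟹ `∃ g : N →ₗ P, ∀ x, f x = g (Q x)`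
   (Mathlib's `Submodule.liftQ` and `LinearMap.quotKerEquivOfSurjective`).
§2 **`dActionL`** is NOT a definition of this file: the first variation `Φ ↦ dAction U (extDir P Φ) W` restricted to the `𝔲(N)` torus fields
   `skewSub d n P` is packaged as a linear map INSIDE the proofs (`NE7ExactCurrent.dAction_add` ∕ `dAction_smul`; `extDir` is pointwise linear).
   **`exists_multiplier`** — let `V` be unitary, `(L·tower L M′ j)`-periodic, `SmallField V x` with `LevelSmall d L j x` (so row NE3-R2's submersion
   `AveragingDeficitMultiLevelFermat.levelQ'_onto` holds at `V`), `U` any configuration, `W` any window; if `dAction U (extDir Φ) W = 0` for every skew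
   torus field `Φ` with `levelQ' L M′ j V Φ = 0` (criticality on the kernel of the constraint's differential — for `U = V` an interior constrained
   minimiser this is the tree's Fermat theorem read on torus fields), then there is a LINEAR MULTIPLIER `Λ : skewSub d n M′ →ₗ[ℝ] ℝ` with
   `dAction U (extDir Φ) W = Λ (levelQ' L M′ j V Φ)` for EVERY skew torus field `Φ`; **`exists_multiplier_periodic`** — the same read on skew
   PERIODIC directions `ψ` of `ℤ^d` (`ψ = extDir (resDir ψ)`).
§3 **`abs_multiplier_le`** — for unitary `U` with `SmallField U a` the multiplier is `O(a)` on every skew preimage: `|Λ γ| ≤ a·Σ_{p∈W}‖(d_U (extDir Φ))(p)‖`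
   whenever `levelQ' Φ = γ` (F3 `NE7OneStepLetters.abs_dAction_le_radius_mul`); a bounded right inverse of `levelQ'` (row NE3-R2's lifts
   `SpreadLift` ∕ `ReplicationRightInverseBound.liftIter`, to be plugged by the user) turns this into `‖Λ‖ = O(a)` — «the Lagrange multiplier of the
   constrained minimiser is O(curvature)», the size that memo H10's LOCAL-FLAT a-priori estimate and CONV-ONE-STEP's slop letter both consume.
HONEST FRAMING (page 1): linear algebra + bookkeeping over HYPOTHESES (criticality on `ker levelQ'`); nothing is asserted about Bałaban's minimisers;
NOT CRIT-ONE-STEP, NOT ONE-STEP, NOT NE7; spine 0∕9; finite T⁴ rung (B)+1 — NOT infinite volume, NOT mass gap, NOT Clay.  Continuum YM on T⁴ ⇐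
BetaPertH ∧ nine spine estimates (0/9 proved); BetaPertH ⇐ (D1) ∧ (D4) ∧ CAP+tail; G-an2-4 gates asym, D1 and NE2/3/4.
-/

set_option autoImplicit false

open scoped BigOperators Matrix.Norms.L2Operator
open NormedSpace Finset Set

namespace Summit.QuantumFields.BalabanUV.T4Continuum.NE7CriticalMultiplier

open Literature.MathematicalPhysics.QuantumFieldTheory.Balaban1983to89
open B7Prop1Explicit B7Prop2Explicit MatrixLog UnitaryModel
open T4AveragingDeficitWall (IsUnitaryCfg IsSkewDir SmallField fineAction vary curl)
open T4AveragingDeficitWallBoundary (IsPeriodicCfg periodBox)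
open AveragingDeficitPeriodicCounting (IsPeriodicDir)
open AveragingDeficitTorusChart (TDir extDir resDir extDir_resDir)
open AveragingDeficitTwoLevelPrep (skewSub)
open AveragingDeficitMultiLevelPrep (tower LevelSmall levelQ')
open AveragingDeficitMultiLevelFermat (levelQ'_onto)
open NE3HessForm (dAction)
open NE7ExactCurrent (dAction_add dAction_smul)
open NE7OneStepLetters (abs_dAction_le_radius_mul)

noncomputable section

/-! ## §1 Linear algebra: a functional vanishing on the kernel of a surjection factors through it -/

/-- **`ker Q ≤ ker f`, `Q` onto ⟹ `f = g ∘ Q`** for linear maps over a ring (first isomorphism theorem). [folklore] -/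
theorem exists_factor_of_ker_le {R M N P : Type*} [Ring R] [AddCommGroup M] [Module R M] [AddCommGroup N] [Module R N]
    [AddCommGroup P] [Module R P] (f : M →ₗ[R] P) (Q : M →ₗ[R] N) (hQ : Function.Surjective Q)
    (h : LinearMap.ker Q ≤ LinearMap.ker f) : ∃ g : N →ₗ[R] P, ∀ x : M, f x = g (Q x) := by
  refine ⟨((LinearMap.ker Q).liftQ f h).comp (Q.quotKerEquivOfSurjective hQ).symm.toLinearMap, fun x => ?_⟩
  simp only [LinearMap.coe_comp, LinearEquiv.coe_coe, Function.comp_apply, LinearMap.quotKerEquivOfSurjective_symm_apply,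
    Submodule.liftQ_apply]

variable {d : ℕ} {n : Type*} [Fintype n] [DecidableEq n]

/-! ## §2 The multiplier of a configuration critical on `ker levelQ'` -/

omit [Fintype n] [DecidableEq n] in
/-- `extDir` is additive. [folklore] -/
theorem extDir_add {P : ℕ} [NeZero P] (Φ Ψ : TDir d n P) : extDir P (Φ + Ψ) = extDir P Φ + extDir P Ψ := by
  funext x κ; rfl

omit [Fintype n] [DecidableEq n] in
/-- `extDir` is `ℝ`-homogeneous. [folklore] -/
theorem extDir_smul {P : ℕ} [NeZero P] (c : ℝ) (Φ : TDir d n P) : extDir P (c • Φ) = c • extDir P Φ := by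
  funext x κ; rfl

/-- **THE LAGRANGE MULTIPLIER.**  `V` unitary, `(L·tower L M′ j)`-periodic, `SmallField V x`, `0 ≤ x`, `LevelSmall d L j x`; `U` any configuration,
`W` any window.  If `dAction U (extDir Φ) W = 0` for every `𝔲(N)` torus field `Φ` in `ker (levelQ' L M′ j V)`, then for some linear
`Λ : skewSub d n M′ →ₗ[ℝ] ℝ`:  `dAction U (extDir Φ) W = Λ (levelQ' L M′ j V Φ)` for EVERY `𝔲(N)` torus field `Φ`. [folklore] -/
theorem exists_multiplier [Nonempty n] {L M' : ℕ} [NeZero L] [NeZero M'] (hL : 1 ≤ L) (j : ℕ)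
    {V : Site d → Fin d → (Matrix n n ℂ)ˣ} {x : ℝ} (hV : IsUnitaryCfg V) (hVP : IsPeriodicCfg V ((L : ℤ) * (tower L M' j : ℕ)))
    (hx : 0 ≤ x) (hls : LevelSmall d L j x) (hVx : SmallField V x)
    (U : Site d → Fin d → (Matrix n n ℂ)ˣ) (W : Finset (T4AveragingDeficitWall.Plaq d))
    (hcrit : ∀ Φ : TDir d n (L * tower L M' j), (∀ r κ, Φ r κ ∈ skewAdjoint (Matrix n n ℂ)) →
      levelQ' L M' j V Φ = 0 → dAction U (extDir (L * tower L M' j) Φ) W = 0) :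
    ∃ Λ : ↥(skewSub d n M') →ₗ[ℝ] ℝ, ∀ Φ : TDir d n (L * tower L M' j), (∀ r κ, Φ r κ ∈ skewAdjoint (Matrix n n ℂ)) →
      dAction U (extDir (L * tower L M' j) Φ) W = Λ (levelQ' L M' j V Φ) := by
  set P : ℕ := L * tower L M' j with hP
  -- the first variation as a linear functional on the `𝔲(N)` torus fields
  let f : ↥(skewSub d n P) →ₗ[ℝ] ℝ :=
    { toFun := fun Φ => dAction U (extDir P (Φ : TDir d n P)) W
      map_add' := fun Φ Ψ => by
        simp only [Submodule.coe_add, extDir_add, dAction_add]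
      map_smul' := fun c Φ => by
        simp only [Submodule.coe_smul, extDir_smul, dAction_smul, smul_eq_mul, RingHom.id_apply] }
  -- the constraint differential restricted to the `𝔲(N)` torus fields
  let Q : ↥(skewSub d n P) →ₗ[ℝ] ↥(skewSub d n M') := (levelQ' L M' j V).toLinearMap.comp (skewSub d n P).subtype
  have hQ : Function.Surjective Q := by
    intro γ
    obtain ⟨Φ, hΦ, hΦγ⟩ := levelQ'_onto (d := d) (n := n) (M' := M') hL j hV hVP hx hls hVx γ
    exact ⟨⟨Φ, hΦ⟩, hΦγ⟩
  have hker : LinearMap.ker Q ≤ LinearMap.ker f := by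
    intro Φ hΦ
    rw [LinearMap.mem_ker] at hΦ ⊢
    exact hcrit (Φ : TDir d n P) Φ.2 hΦ
  obtain ⟨g, hg⟩ := exists_factor_of_ker_le f Q hQ hker
  refine ⟨g, fun Φ hΦ => ?_⟩
  exact hg ⟨Φ, hΦ⟩

/-- **THE SAME ON PERIODIC DIRECTIONS OF `ℤ^d`**: under the hypotheses of `exists_multiplier`, for every skew `(L·tower L M′ j)`-periodic `ψ`,
`dAction U ψ W = Λ (levelQ' L M′ j V (resDir ψ))` (`ψ = extDir (resDir ψ)`). [folklore] -/
theorem exists_multiplier_periodic [Nonempty n] {L M' : ℕ} [NeZero L] [NeZero M'] (hL : 1 ≤ L) (j : ℕ)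
    {V : Site d → Fin d → (Matrix n n ℂ)ˣ} {x : ℝ} (hV : IsUnitaryCfg V) (hVP : IsPeriodicCfg V ((L : ℤ) * (tower L M' j : ℕ)))
    (hx : 0 ≤ x) (hls : LevelSmall d L j x) (hVx : SmallField V x)
    (U : Site d → Fin d → (Matrix n n ℂ)ˣ) (W : Finset (T4AveragingDeficitWall.Plaq d))
    (hcrit : ∀ Φ : TDir d n (L * tower L M' j), (∀ r κ, Φ r κ ∈ skewAdjoint (Matrix n n ℂ)) →
      levelQ' L M' j V Φ = 0 → dAction U (extDir (L * tower L M' j) Φ) W = 0) :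
    ∃ Λ : ↥(skewSub d n M') →ₗ[ℝ] ℝ, ∀ ψ : Site d → Fin d → Matrix n n ℂ, IsSkewDir ψ → IsPeriodicDir ψ ((L * tower L M' j : ℕ) : ℤ) →
      dAction U ψ W = Λ (levelQ' L M' j V (resDir (L * tower L M' j) ψ)) := by
  haveI : NeZero (L * tower L M' j) := ⟨Nat.mul_ne_zero (NeZero.ne L) (AveragingDeficitMultiLevelPrep.tower_ne_zero L M' j)⟩
  obtain ⟨Λ, hΛ⟩ := exists_multiplier hL j hV hVP hx hls hVx U W hcrit
  refine ⟨Λ, fun ψ hψs hψP => ?_⟩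
  have hres : ∀ r κ, resDir (L * tower L M' j) ψ r κ ∈ skewAdjoint (Matrix n n ℂ) := fun r κ => hψs _ _
  have h := hΛ (resDir (L * tower L M' j) ψ) hres
  rwa [extDir_resDir (L * tower L M' j) hψP] at h

/-! ## §3 The multiplier is `O(radius)` on every skew preimage -/

/-- **`|Λ γ| ≤ a·Σ_{p∈W}‖(d_U (extDir Φ))(p)‖` FOR EVERY SKEW PREIMAGE `Φ` OF `γ`**, when `U` is unitary with `SmallField U a` and `Λ` represents the
first variation as in `exists_multiplier` (F3's `abs_dAction_le_radius_mul`). [folklore] -/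
theorem abs_multiplier_le [Nonempty n] {L M' : ℕ} [NeZero L] [NeZero M'] (j : ℕ) {V U : Site d → Fin d → (Matrix n n ℂ)ˣ}
    (hU : IsUnitaryCfg U) {a : ℝ} (hUa : SmallField U a) (W : Finset (T4AveragingDeficitWall.Plaq d))
    {Λ : ↥(skewSub d n M') →ₗ[ℝ] ℝ}
    (hΛ : ∀ Φ : TDir d n (L * tower L M' j), (∀ r κ, Φ r κ ∈ skewAdjoint (Matrix n n ℂ)) →
      dAction U (extDir (L * tower L M' j) Φ) W = Λ (levelQ' L M' j V Φ))
    {Φ : TDir d n (L * tower L M' j)} (hΦ : ∀ r κ, Φ r κ ∈ skewAdjoint (Matrix n n ℂ)) {γ : ↥(skewSub d n M')}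
    (hΦγ : levelQ' L M' j V Φ = γ) :
    |Λ γ| ≤ a * ∑ p ∈ W, ‖curl U (extDir (L * tower L M' j) Φ) p‖ := by
  haveI : NeZero (L * tower L M' j) := ⟨Nat.mul_ne_zero (NeZero.ne L) (AveragingDeficitMultiLevelPrep.tower_ne_zero L M' j)⟩
  rw [← hΦγ, ← hΛ Φ hΦ]
  have hskew : IsSkewDir (extDir (L * tower L M' j) Φ) := fun x κ => hΦ _ _
  exact abs_dAction_le_radius_mul hU hskew hUa W

end

end Summit.QuantumFields.BalabanUV.T4Continuum.NE7CriticalMultiplier
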